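import Mathlib
import Literature.Geometry.Riemannian.HamiltonCurvatureODE
import Literature.Geometry.Riemannian.RicciFlowMaximal
import Literature.Geometry.Riemannian.ConstantCurvature
import HarnessLib

/-!
# HamiltonConvergenceCriterion

Topic `Literature/Geometry/Riemannian`. Named literature fact(s) relocated by the gate from `Summits/SmoothPoincare4/SmoothPoincare4/Theorems/EntropyRungChangGurskyYangStubPinchedFlowConvergence.lean`
(accept-time relocation of `[cite]`d propositions written inline in a Summits proposal; human ruling 2026-08-15).
Sources: Hamilton1982, Hamilton1986, Huisken1985.

* `Literature.Geometry.Riemannian.hamilton_convergenceCriterion_four`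
-/

namespace Literature.Geometry.Riemannian

open Set Function
open scoped Manifold ContDiff Matrix BigOperators Topology
open Literature.Geometry.Riemannian Literature.Geometry.Riemannian.HamiltonODE
open Literature.Geometry.Lorentzian Literature.Geometry.Lorentzian.PseudoRiemannianMetric

/-- NAMED FACT (**Hamilton 1986, §5, 5.2 "Convergence criterion"**, J. Differential Geom. 24,
p. 164: "If `U` satisfies the pinching condition, and `tr M > 0` for all `M ∈ Z`, then every metric
whose curvature lies in `U` will evolve as `t → ∞` to a metric of constant positive curvature";
Def. 5.1 (p. 163): a pinching set `Z` is closed, convex, `O(n)`-invariant, invariant under the ODE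
`dM/dt = M² + M^#`, with "`|M̊| ≤ C|M|^{1−δ}` for some `C` and all `M ∈ Z`"; printed proof of 5.2:
"Since the manifold is compact, we can find a pinching set `Z` … such that at time `t = 0` the
curvature operator `M` lies in `X = P ×_G Z`. Then it will remain in `X` by the argument in §4. This
gives us the required pinching estimate `|M̊| ≤ C|M|^{1−δ}`"; §5, p. 163: "All we need is to show
that if `M̊` is the traceless part of `M`, then `|M̊| ≤ C|M|^{1−δ}` for some `δ > 0` and some constant
`C`"; §2, p. 154: "the Riemannian curvature tensor must pinch toward a multiple of the identity as
the scalar curvature `R` blows up, in the sense that `|R̊m| ≤ C R^{1−δ}` for some `δ > 0` … When this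
estimate holds, the rest of the proof goes through unchanged" — i.e. Hamilton 1982, §§10–17, in
dimension `n ≥ 4` Huisken 1985, Thm. 3.1 and §4 — and p. 154: "the solution exists for all time `t`
and converges as `t → ∞` to a metric of constant Riemannian curvature"). **Vended form** — the
special case `n = 4`, with
the pinching set taken in the explicit form `Z = {tr A + tr C ≥ m} ∩ {|M̊|² ≤ K (tr A + tr C)^{2−τ}}`
(`m, K, τ > 0`; `δ = τ/2`) in Hamilton's block coordinates `M = (A B; ᵗB C)` of the curvature
operator on `Λ²₊ ⊕ Λ²₋` in an orthonormal frame (`PseudoRiemannianMetric.blockA/B/C`,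
`CurvatureDecomposition.lean`; `tr M = tr A + tr C = R`, `|M|² = ‖A‖² + 2‖B‖² + ‖C‖²`,
`|M̊|² = |M|² − (tr M)²/6 = |W|² + 2|E|² = |R̊m|²`), and with the preservation step ("it will remain
in `X`", §4) folded into the hypothesis, which is stated along EVERY Ricci flow from the initial
metric (`IsRicciFlow`, `RicciFlow.lean`; the tree carries Levi-Civita connections as explicit
witnesses): for a compact, Hausdorff, second countable, connected `C^∞` 4-manifold `M` on `ℝ⁴` and
a `C^∞` Riemannian metric `g₀` on `TM`, if along every Ricci flow of Riemannian metrics `(g, cov)`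
on `[0, T)` with `g 0 = g₀`, at every time, point and `g t`-orthonormal frame, the blocks satisfy
`m ≤ tr A + tr C` and `Σ Aᵢⱼ² + 2 Σ Bᵢⱼ² + Σ Cᵢⱼ² − (tr A + tr C)²/6 ≤ K (tr A + tr C)^{2−τ}`, then
`M` carries a `C^∞` Riemannian metric of constant sectional curvature `k > 0`
(`HasConstantSectionalCurvature`, `ConstantCurvature.lean`: the limit of the normalised flow) — the
form in which the tree consumes the convergence of the normalised flow (hypothesis `h₁` of
`hamilton_positiveCurvatureOperator_classification_four_of_constantCurvature`). Connectedness is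
the standing meaning of "manifold" in the source (on `S⁴ ⊔ S⁴(2)` the volume-normalised flow does
not converge); `m > 0` is "`tr M > 0` on `Z`" (`Z` closed, avoiding the apex; `R_min` is
non-decreasing). The scoped notations `𝓡 4` and `∞` are written out
(`modelWithCornersSelf ℝ (EuclideanSpace ℝ (Fin 4))`, `((⊤ : ℕ∞) : WithTop ℕ∞)`) so that the term
parses without `open scoped`. Users take `(h : hamilton_convergenceCriterion_four)`.
-- TODO(general form): Hamilton 1986, 5.2 for an arbitrary pinching set `Z` (Def. 5.1: closed,
-- convex, `O(n)`-invariant, ODE-invariant, `|M̊| ≤ C|M|^{1−δ}` on `Z`) and an open `U ⊆ so(n)`-forms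
-- satisfying the pinching condition, in every dimension `n`, with the conclusion "the normalised
-- Ricci flow exists for all time and converges in `C^∞` to constant positive curvature".
[cite: Hamilton1986, §5, 5.2 Convergence criterion (p. 164), Def. 5.1 (p. 163) and §2 (p. 154)]
[cite: Hamilton1982, §§10–17] [cite: Huisken1985, Thm. 3.1 and §4 (pp. 52, 60–61)]
[file Geometry/Riemannian/HamiltonConvergenceCriterion] -/
def hamilton_convergenceCriterion_four : Prop :=
  ∀ (M : Type) [TopologicalSpace M] [T2Space M] [SecondCountableTopology M]
    [ChartedSpace (EuclideanSpace ℝ (Fin 4)) M]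
    [IsManifold (modelWithCornersSelf ℝ (EuclideanSpace ℝ (Fin 4))) ((⊤ : ℕ∞) : WithTop ℕ∞) M]
    [CompactSpace M] [ConnectedSpace M]
    (g₀ : Literature.Geometry.Lorentzian.PseudoRiemannianMetric
      (modelWithCornersSelf ℝ (EuclideanSpace ℝ (Fin 4))) ((⊤ : ℕ∞) : WithTop ℕ∞)
      (EuclideanSpace ℝ (Fin 4))
      (TangentSpace (modelWithCornersSelf ℝ (EuclideanSpace ℝ (Fin 4))) : M → Type _))
    (m K τ : ℝ), g₀.IsRiemannian → 0 < m → 0 < K → 0 < τ →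
    (∀ (T : ℝ)
      (g : ℝ → Literature.Geometry.Lorentzian.PseudoRiemannianMetric
        (modelWithCornersSelf ℝ (EuclideanSpace ℝ (Fin 4))) ((⊤ : ℕ∞) : WithTop ℕ∞)
        (EuclideanSpace ℝ (Fin 4))
        (TangentSpace (modelWithCornersSelf ℝ (EuclideanSpace ℝ (Fin 4))) : M → Type _))
      (cov : ℝ → CovariantDerivative (modelWithCornersSelf ℝ (EuclideanSpace ℝ (Fin 4)))
        (EuclideanSpace ℝ (Fin 4))
        (TangentSpace (modelWithCornersSelf ℝ (EuclideanSpace ℝ (Fin 4))) : M → Type _)),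
      Literature.Geometry.Riemannian.IsRicciFlow g cov (Set.Ico 0 T) →
      (∀ t ∈ Set.Ico 0 T, (g t).IsRiemannian) → g 0 = g₀ →
      ∀ t ∈ Set.Ico 0 T, ∀ (x : M)
        (e : Fin 4 → TangentSpace (modelWithCornersSelf ℝ (EuclideanSpace ℝ (Fin 4))) x),
        (g t).IsOrthonormalFrame x e →
          ((g t).blockA (cov t) x e, (g t).blockB (cov t) x e, (g t).blockC (cov t) x e) ∈
            {p : Matrix (Fin 3) (Fin 3) ℝ × Matrix (Fin 3) (Fin 3) ℝ × Matrix (Fin 3) (Fin 3) ℝ |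
              m ≤ p.1.trace + p.2.2.trace ∧
              (∑ i, ∑ j, p.1 i j ^ 2) + 2 * (∑ i, ∑ j, p.2.1 i j ^ 2) + (∑ i, ∑ j, p.2.2 i j ^ 2) -
                  (p.1.trace + p.2.2.trace) ^ 2 / 6 ≤
                K * (p.1.trace + p.2.2.trace) ^ (2 - τ)}) →
    ∃ (k : ℝ) (g' : Literature.Geometry.Lorentzian.PseudoRiemannianMetric
        (modelWithCornersSelf ℝ (EuclideanSpace ℝ (Fin 4))) ((⊤ : ℕ∞) : WithTop ℕ∞)
        (EuclideanSpace ℝ (Fin 4))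
        (TangentSpace (modelWithCornersSelf ℝ (EuclideanSpace ℝ (Fin 4))) : M → Type _)),
      0 < k ∧ g'.IsRiemannian ∧ g'.HasConstantSectionalCurvature k

/-! ## STUB 4, conditionally on the criterion -/

end Literature.Geometry.Riemannian
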